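import Literature.AlgebraicGeometry.Frobenioids.PadicKummerDualityIsoLocalField
import Literature.AlgebraicGeometry.Frobenioids.PadicKummerLocalFieldIsoIntegers
import Literature.AlgebraicGeometry.Frobenioids.PadicKummerIsoKummerMaps
import HarnessLib

/-!
# Frobenioids II, Theorem 2.4 (i): the field-isomorphism case is UNCONDITIONAL at the binding

Mochizuki, *The geometry of Frobenioids II*, Kyushu J. Math. **62** (2008) 401–460, §2, Theorem 2.4 (i)
pp. 19–20 [cite: MochizukiFrdII2008, Thm 2.4 (i) p.19]: "`Φ₁` is fieldwise saturated if and only if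
`Φ₂` is. Moreover, `p₁ = p₂`; `Ψ` maps `(N, H₁)`-saturated objects to `(N, H₂)`-saturated objects and
induces isomorphisms … compatible with the respective Kummer and reciprocity maps".

PROOF-ONLY corollary (abc-iut-L2-t12, gen 3; kernel probe of abc-iut-L1-d4's
`PadicKummerLocalFieldIsoIntegers.lean` composed with `PadicKummerDualityIsoLocalField.lean`). For the
context isomorphism `Def22Context.Iso.ofLocalFieldBox φ₀ hφ₀ φ hφ L₁ L₂ hL H₁ hH₁ H₂ hH₂ hH fs` induced
by an isomorphism of the FIELD DATA (`φ₀ : K₁ ≃ K₂` identifying the valuation rings, `φ : K̄₁ ≃ K̄₂`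
over it carrying `L₁` onto `L₂` and `H₁` onto `H₂`) between the arithmetic contexts with `O^□` as in
Definition 2.2 (iii) for ONE flag `fs` ("`Φ` fieldwise saturated"), the residual input `hfs : fs ↔ fs`
of `Def22Context.Iso.thm24i_ofLocalField` is `Iff.rfl`: the typed **Theorem 2.4 (i) holds with NO
residual input** for this class of `Ψ` (`thm24i_ofLocalFieldBox`), and so does "(γ₁)"
(`recTargetMap_dualityIsoOfLocalFieldBox`). This is a non-vacuity witness for the typed `Thm24i` at
the binding (its hypotheses `hSᵢ` are automatic for `O^□`, `mem_boxStableSubmonoid_of_pow_eq_one`; an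
`(N, H₁)`-saturated `A₁` exists cofinally, `exists_dualityIso_hypotheses_ofLocalField`). REMARK
(honest scope): for a general `Ψ` the isomorphism `G₁ ⥲ G₂` need not come from a field isomorphism and
`hfs` is the Frobenioid-side statement [FrdI] Cor. 4.10/4.11 (cell row W12-L03); nothing here concerns
[IUTchIII]. No definitions.
-/

noncomputable section

namespace Literature.AlgebraicGeometry.Frobenioids

namespace PadicKummer

namespace Def22Context.Iso

open Field IntermediateField Kummer
open scoped ValuativeRel
open Literature.NumberTheory.GaloisRepresentations

variable {K₁ K₂ : Type} [Field K₁] [Field K₂] [ValuativeRel K₁] [ValuativeRel K₂]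
  [TopologicalSpace K₁] [IsNonarchimedeanLocalField K₁] [CharZero K₁]
  [TopologicalSpace K₂] [IsNonarchimedeanLocalField K₂] [CharZero K₂]
  (φ₀ : K₁ ≃+* K₂) (hφ₀ : ∀ x : K₁, x ∈ 𝒪[K₁] ↔ φ₀ x ∈ 𝒪[K₂])
  (φ : AlgebraicClosure K₁ ≃+* AlgebraicClosure K₂)
  (hφ : ∀ x : K₁, φ (algebraMap K₁ (AlgebraicClosure K₁) x) =
    algebraMap K₂ (AlgebraicClosure K₂) (φ₀ x))
  (L₁ : IntermediateField K₁ (AlgebraicClosure K₁)) (L₂ : IntermediateField K₂ (AlgebraicClosure K₂))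
  [Normal K₁ L₁] [FiniteDimensional K₁ L₁] [Normal K₂ L₂] [FiniteDimensional K₂ L₂]
  (hL : ∀ y : AlgebraicClosure K₁, y ∈ L₁ ↔ φ y ∈ L₂)
  (H₁ : Subgroup (absoluteGaloisGroup K₁)) [H₁.Normal]
  (hH₁ : IsOpen (H₁ : Set (absoluteGaloisGroup K₁)))
  (H₂ : Subgroup (absoluteGaloisGroup K₂)) [H₂.Normal]
  (hH₂ : IsOpen (H₂ : Set (absoluteGaloisGroup K₂)))
  (hH : H₁.map (galConjₜ φ₀ φ hφ).toMulEquiv.toMonoidHom = H₂)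
  (fs : Prop) (N : ℕ) [NeZero N]

/-- `O^□_{L}` contains the `N`-th roots of unity of `L` (both for `O^⊳` and `O^×`), so the hypothesis
`hS` of `dualityIsoOfLocalField` is automatic at `boxStableSubmonoid`.
[cite: MochizukiFrdII2008, Def 2.2 (iii) p.18] -/
theorem hS_box {K : Type} [Field K] [ValuativeRel K] (L : IntermediateField K (AlgebraicClosure K))
    (fs : Prop) (N : ℕ) [NeZero N] :
    ∀ x : L, x ^ N = 1 → x ∈ (boxStableSubmonoid K L fs).toSubmonoid := fun _ hx =>
  mem_boxStableSubmonoid_of_pow_eq_one K L N fs (NeZero.pos N) hx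

/-- **Theorem 2.4 (i), "(γ₁)", for the field-isomorphism `Ψ`**: along
`Iso.ofLocalFieldBox φ₀ hφ₀ φ hφ L₁ L₂ hL H₁ hH₁ H₂ hH₂ hH fs` the constructed duality isomorphisms
satisfy `(isoHA^ab ⊗ isoFN) ∘ ι₁ = ι₂ ∘ isoH1`, for `(N, Hᵢ)`-saturated `Aᵢ` — no residual input.
[cite: MochizukiFrdII2008, Thm 2.4 (i) p.19] -/
theorem recTargetMap_dualityIsoOfLocalFieldBox
    (h₁ : IsNHSaturated (Def22Context.ofLocalField L₁ H₁ hH₁ (boxStableSubmonoid K₁ L₁ fs)) N)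
    (h₂ : IsNHSaturated (Def22Context.ofLocalField L₂ H₂ hH₂ (boxStableSubmonoid K₂ L₂ fs)) N)
    (c : groupCohomology.H1 (Rep.ofMulDistribMulAction
      (Def22Context.ofLocalField L₁ H₁ hH₁ (boxStableSubmonoid K₁ L₁ fs)).HA
      (Mu N (Def22Context.ofLocalField L₁ H₁ hH₁ (boxStableSubmonoid K₁ L₁ fs)).O))) :
    ((ofLocalFieldBox φ₀ hφ₀ φ hφ L₁ L₂ hL H₁ hH₁ H₂ hH₂ hH fs).thm24Data N).recTargetMap
        (dualityApply _ N (dualityIsoOfLocalField L₁ H₁ hH₁ _ N (hS_box L₁ fs N) h₁) c) =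
      dualityApply _ N (dualityIsoOfLocalField L₂ H₂ hH₂ _ N (hS_box L₂ fs N) h₂)
        ((ofLocalFieldBox φ₀ hφ₀ φ hφ L₁ L₂ hL H₁ hH₁ H₂ hH₂ hH fs).isoH1 N c) :=
  (ofLocalFieldBox φ₀ hφ₀ φ hφ L₁ L₂ hL H₁ hH₁ H₂ hH₂ hH fs).recTargetMap_dualityIsoOfLocalField N
    _ h₁ _ h₂ c

/-- **Theorem 2.4 (i) UNCONDITIONALLY for the field-isomorphism `Ψ`**: for base fields
`Kᵢ ⊇ ℚ_{pᵢ}` (finite) and the context isomorphism induced by an isomorphism of the field data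
carrying `O^□_{L₁}` onto `O^□_{L₂}` (same flag `fs`), the typed `Thm24i` holds for an
`(N, H₁)`-saturated `A₁` with the CONSTRUCTED duality isomorphisms — `p₁ = p₂` from [AbsAnab]
Prop. 1.2.1 (i), `hfs := Iff.rfl`, everything else proved. [cite: MochizukiFrdII2008, Thm 2.4 (i) p.19] -/
theorem thm24i_ofLocalFieldBox {p₁ p₂ : ℕ} [Fact p₁.Prime] [Fact p₂.Prime]
    [Algebra ℚ_[p₁] K₁] [FiniteDimensional ℚ_[p₁] K₁] [Algebra ℚ_[p₂] K₂] [FiniteDimensional ℚ_[p₂] K₂]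
    (h₁ : IsNHSaturated (Def22Context.ofLocalField L₁ H₁ hH₁ (boxStableSubmonoid K₁ L₁ fs)) N) :
    Thm24i (Def22Context.ofLocalField L₁ H₁ hH₁ (boxStableSubmonoid K₁ L₁ fs))
      (Def22Context.ofLocalField L₂ H₂ hH₂ (boxStableSubmonoid K₂ L₂ fs)) N p₁ p₂ fs fs
      ((ofLocalFieldBox φ₀ hφ₀ φ hφ L₁ L₂ hL H₁ hH₁ H₂ hH₂ hH fs).thm24Data N)
      (dualityIsoOfLocalField L₁ H₁ hH₁ _ N (hS_box L₁ fs N) h₁)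
      (dualityIsoOfLocalField L₂ H₂ hH₂ _ N (hS_box L₂ fs N)
        (((ofLocalFieldBox φ₀ hφ₀ φ hφ L₁ L₂ hL H₁ hH₁ H₂ hH₂ hH fs).isNHSaturated_iff N).mp h₁)) :=
  (ofLocalFieldBox φ₀ hφ₀ φ hφ L₁ L₂ hL H₁ hH₁ H₂ hH₂ hH fs).thm24i_ofLocalField N fs fs Iff.rfl
    _ h₁ _

include φ₀ hφ₀ φ hφ L₂ hL H₂ hH₂ hH in
/-- In particular `p₁ = p₂` for two such base fields admitting an isomorphism of field data carrying
the arithmetic contexts onto each other (the second clause of `Thm24i`, read off).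
[cite: MochizukiFrdII2008, Thm 2.4 (i) p.20] -/
theorem residueChar_eq_ofLocalFieldBox {p₁ p₂ : ℕ} [Fact p₁.Prime] [Fact p₂.Prime]
    [Algebra ℚ_[p₁] K₁] [FiniteDimensional ℚ_[p₁] K₁] [Algebra ℚ_[p₂] K₂] [FiniteDimensional ℚ_[p₂] K₂]
    (h₁ : IsNHSaturated (Def22Context.ofLocalField L₁ H₁ hH₁ (boxStableSubmonoid K₁ L₁ fs)) N) : p₁ = p₂ :=
  (thm24i_ofLocalFieldBox φ₀ hφ₀ φ hφ L₁ L₂ hL H₁ hH₁ H₂ hH₂ hH fs N h₁).2.1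

end Def22Context.Iso

/-! ### v2 (append-only): "compatible with the respective reciprocity maps" for the maps of
Definition 2.3 themselves, with NO naturality input (abc-iut-L1-d4's `recTargetMap_reciprocityMap`
took the naturality `hι` of the duality isomorphisms as a named input; for the CONSTRUCTED isomorphisms
it is `recTargetMap_dualityIsoOfBijective`). -/

namespace Def22Context.Iso

open Kummer

section AnyContextReciprocity

variable {X₁ X₂ : Def22Context} (f : Def22Context.Iso X₁ X₂) (N : ℕ)

/-- **Theorem 2.4 (i), "compatible with the respective reciprocity maps
`O^□(Aᵢ)^{Hᵢ} → (Hᵢ)^ab_{Aᵢ} ⊗ F_N(Aᵢ)`" with NO residual input**, for abc-iut-L1-t4's Definition 2.3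
reciprocity maps fed with the CONSTRUCTED duality isomorphisms (`reciprocityMapOf Xᵢ N … (dualityIsoOfBijective …)`):
the square `(isoHA^ab ⊗ isoFN) ∘ ρ₁ = ρ₂ ∘ isoInvariants` commutes along every context isomorphism
(abc-iut-L1-d4's `recTargetMap_reciprocityMap` with its input `hι` DISCHARGED by
`recTargetMap_dualityIsoOfBijective`). [cite: MochizukiFrdII2008, Thm 2.4 (i) p.19] -/
theorem recTargetMap_reciprocityMapOf (hO₁ : NthRootsDifferByUnits N X₁.O)
    (hO₂ : NthRootsDifferByUnits N X₂.O) (hR₁ : InvariantsAdmitRoots N X₁.O X₁.HA)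
    (hR₂ : InvariantsAdmitRoots N X₂.O X₂.HA)
    (hθ₁ : Function.Bijective (thetaHomOf X₁ N)) (hcup₁ : Function.Bijective (cupDualOf X₁ N))
    (hθ₂ : Function.Bijective (thetaHomOf X₂ N)) (hcup₂ : Function.Bijective (cupDualOf X₂ N))
    (x : invariantsSubmonoid X₁.O X₁.HA) :
    (f.thm24Data N).recTargetMap (Multiplicative.toAdd
        (reciprocityMapOf X₁ N hO₁ hR₁ (dualityIsoOfBijective X₁ N hθ₁ hcup₁) x)) =
      Multiplicative.toAdd
        (reciprocityMapOf X₂ N hO₂ hR₂ (dualityIsoOfBijective X₂ N hθ₂ hcup₂) (f.isoInvariants x)) :=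
  f.recTargetMap_reciprocityMap N hO₁ hO₂ hR₁ hR₂ _ _
    (f.recTargetMap_dualityIsoOfBijective N hθ₁ hcup₁ hθ₂ hcup₂) x

end AnyContextReciprocity

section LocalFieldReciprocity

open Field IntermediateField
open Literature.NumberTheory.GaloisRepresentations

variable {K₁ : Type} [Field K₁] [ValuativeRel K₁] [TopologicalSpace K₁]
  [IsNonarchimedeanLocalField K₁] [CharZero K₁]
  {K₂ : Type} [Field K₂] [ValuativeRel K₂] [TopologicalSpace K₂]
  [IsNonarchimedeanLocalField K₂] [CharZero K₂]
  {L₁ : IntermediateField K₁ (AlgebraicClosure K₁)} [Normal K₁ L₁] [FiniteDimensional K₁ L₁]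
  {H₁ : Subgroup (absoluteGaloisGroup K₁)} [H₁.Normal] {hH₁ : IsOpen (H₁ : Set (absoluteGaloisGroup K₁))}
  {S₁ : StableSubmonoid L₁}
  {L₂ : IntermediateField K₂ (AlgebraicClosure K₂)} [Normal K₂ L₂] [FiniteDimensional K₂ L₂]
  {H₂ : Subgroup (absoluteGaloisGroup K₂)} [H₂.Normal] {hH₂ : IsOpen (H₂ : Set (absoluteGaloisGroup K₂))}
  {S₂ : StableSubmonoid L₂}
  (f : Iso (Def22Context.ofLocalField L₁ H₁ hH₁ S₁) (Def22Context.ofLocalField L₂ H₂ hH₂ S₂))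
  (N : ℕ) [NeZero N]

/-- **Theorem 2.4 (i), reciprocity-map compatibility at the arithmetic binding, NO residual input**:
along every isomorphism of two local-field contexts, the reciprocity maps of Definition 2.3 with the
constructed duality isomorphisms (`reciprocityMapOfLocalField`, defined on all of `O^□(Aᵢ)^{Hᵢ}` by
`hRᵢ`, Rmk. 2.2.1) correspond under `isoInvariants` and `isoHA^ab ⊗ isoFN`.
[cite: MochizukiFrdII2008, Thm 2.4 (i) p.19] -/
theorem recTargetMap_reciprocityMapOfLocalField
    (hS₁ : ∀ x : L₁, x ^ N = 1 → x ∈ S₁.toSubmonoid)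
    (h₁ : IsNHSaturated (Def22Context.ofLocalField L₁ H₁ hH₁ S₁) N)
    (hR₁ : InvariantsAdmitRoots N (Def22Context.ofLocalField L₁ H₁ hH₁ S₁).O
      (Def22Context.ofLocalField L₁ H₁ hH₁ S₁).HA)
    (hS₂ : ∀ x : L₂, x ^ N = 1 → x ∈ S₂.toSubmonoid)
    (h₂ : IsNHSaturated (Def22Context.ofLocalField L₂ H₂ hH₂ S₂) N)
    (hR₂ : InvariantsAdmitRoots N (Def22Context.ofLocalField L₂ H₂ hH₂ S₂).O
      (Def22Context.ofLocalField L₂ H₂ hH₂ S₂).HA)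
    (x : invariantsSubmonoid (Def22Context.ofLocalField L₁ H₁ hH₁ S₁).O
      (Def22Context.ofLocalField L₁ H₁ hH₁ S₁).HA) :
    (f.thm24Data N).recTargetMap (Multiplicative.toAdd
        (reciprocityMapOfLocalField L₁ H₁ hH₁ S₁ N hS₁ h₁ hR₁ x)) =
      Multiplicative.toAdd
        (reciprocityMapOfLocalField L₂ H₂ hH₂ S₂ N hS₂ h₂ hR₂ (f.isoInvariants x)) :=
  f.recTargetMap_reciprocityMapOf N _ _ hR₁ hR₂ _ _ _ _ x

end LocalFieldReciprocity

end Def22Context.Iso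

end PadicKummer

end Literature.AlgebraicGeometry.Frobenioids

end
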